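import Literature.Barriers.CriticalPhenomena.IsingTrivialityFromDimensionFourProofs
import Literature.Probability.LatticeModels.IsingFieldModel
import Literature.Probability.LatticeModels.PlusStateFKG

/-!
# Block-field domination (stub `stub_blockFieldDomination`, line `SketchPub`)

Crux `CoulombImpliesNontrivial` of route `PerfectScreening` (Ising3DConformalLimit), registered stub S3:
switching the field `h ≥ 0` on inside the block `B_L = box 3 L` only magnetises the block at most as
much as the homogeneous field does,
`⟨M_L e^{β_c h M_L}⟩_{β_c,0} ≤ (2L+1)³ · m(β_c, h) · ⟨e^{β_c h M_L}⟩_{β_c,0}`.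

Proof. FINITE VOLUME (`isingExpect_spinAt_mul_blockTilt_le`): in a plus box `Λ ⊇ B`, tilting the
zero-field weights by `R = e^{β h M_B}` is the site-dependent-field model with field `h·1_B`
(`fieldWeight_field_tilt`, tree convention `e^{-βℋ} = e^{β Σσσ + β Σ h_x σ_x}`), so
`⟨σ_x R⟩⁺_{Λ;β,0} / ⟨R⟩⁺_{Λ;β,0} = ⟨σ_x⟩⁺_{Λ;β,h·1_B} ≤ ⟨σ_x⟩⁺_{Λ;β,h}` by monotonicity in the field
(`fieldExpect_mono_field`, FKG; Friedli–Velenik 2017, Lemma 3.31). Summing over `x ∈ B`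
(`isingExpect_blockSpin_mul_blockTilt_le`) and letting `Λ = box 3 M ↑ ℤ³`: the plus boxes converge on
local observables (`tendsto_isingExpect_plus_spinFun`) and `⟨σ_x⟩⁺_{β,h} = ⟨σ₀⟩⁺_{β,h} = m(β,h)`
(`plusExpect_spinAt_eq_plusExpect_spinAt_zero`, translation invariance); `|box 3 L| = (2L+1)³`.
-/

noncomputable section

namespace Summit.CriticalPhenomena.Ising3DConformalLimit.PerfectScreeningCoulombImpliesNontrivial

open Literature.Probability.LatticeModels Filter Set Finset
open scoped Topology BigOperators
open MeasureTheory Literature.Barriers.CriticalPhenomena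

variable {d : ℕ}

/-- The block tilt `R = exp(β h M_B)` is measurable. -/
theorem measurable_blockTilt (β h : ℝ) (B : Finset (Site d)) :
    Measurable (fun σ : SpinConfig (Site d) => Real.exp (β * h * ∑ y ∈ B, spinAt y σ)) :=
  Real.measurable_exp.comp ((Finset.measurable_sum _ fun y _ => measurable_spinAt y).const_mul _)

/-- **Finite-volume block-field domination, one site** (FKG monotonicity in the field): for
`β, h ≥ 0`, a plus box `Λ ⊇ B` and any site `x`,
`⟨σ_x e^{β h M_B}⟩⁺_{Λ;β,0} ≤ ⟨σ_x⟩⁺_{Λ;β,h} · ⟨e^{β h M_B}⟩⁺_{Λ;β,0}`: the tilt by `e^{β h M_B}` is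
the model with the site-dependent field `h·1_B ≤ h` (Friedli–Velenik 2017, Lemma 3.31 (1)). -/
theorem isingExpect_spinAt_mul_blockTilt_le {β h : ℝ} (hβ : 0 ≤ β) (hh : 0 ≤ h)
    {Λ B : Finset (Site d)} (hB : B ⊆ Λ) (x : Site d) :
    isingExpect (zdGraph d) Λ β 0 .plus
        (fun σ => spinAt x σ * Real.exp (β * h * ∑ y ∈ B, spinAt y σ)) ≤
      isingExpect (zdGraph d) Λ β h .plus (spinAt x) *
        isingExpect (zdGraph d) Λ β 0 .plus (fun σ => Real.exp (β * h * ∑ y ∈ B, spinAt y σ)) := by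
  classical
  have hRm := measurable_blockTilt (d := d) β h B
  have hRpos : ∀ σ : SpinConfig (Site d), 0 < Real.exp (β * h * ∑ y ∈ B, spinAt y σ) :=
    fun σ => Real.exp_pos _
  -- the block field `h·1_B`
  have hsum : ∀ σ : SpinConfig (Site d),
      β * ∑ y ∈ Λ, ((if y ∈ B then h else 0) - 0) * spinAt y σ = β * h * ∑ y ∈ B, spinAt y σ := by
    intro σ
    simp only [sub_zero, ite_mul, zero_mul]
    rw [Finset.sum_ite_mem, Finset.inter_eq_right.2 hB, ← Finset.mul_sum, mul_assoc]
  have hw : ∀ τ : ↥Λ → ℤˣ,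
      fieldWeight (zdGraph d) Λ β (fun y => if y ∈ B then h else 0) .plus τ =
        fieldWeight (zdGraph d) Λ β (fun _ => (0 : ℝ)) .plus τ *
          Real.exp (β * h * ∑ y ∈ B, spinAt y (glue Λ τ .plus)) := by
    intro τ
    rw [fieldWeight_field_tilt (zdGraph d) Λ β (fun _ => (0 : ℝ)) (fun y => if y ∈ B then h else 0)
      .plus τ, hsum]
  have htilt := fieldExpect_eq_div_of_weight_eq (zdGraph d)
    (bc₁ := BoundaryCondition.plus) (bc₂ := BoundaryCondition.plus) rfl hRm hw (measurable_spinAt x)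
  have hmono : fieldExpect (zdGraph d) Λ β (fun y => if y ∈ B then h else 0) .plus (spinAt x) ≤
      fieldExpect (zdGraph d) Λ β (fun _ => h) .plus (spinAt x) :=
    fieldExpect_mono_field (zdGraph d) hβ
      (fun y _ => by
        show (if y ∈ B then h else 0) ≤ h
        split_ifs
        · exact le_rfl
        · exact hh)
      .plus (spinAt_mono x) (measurable_spinAt x)
  rw [htilt, fieldExpect_const, fieldExpect_const, fieldExpect_const,
    div_le_iff₀ (isingExpect_pos _ _ _ _ _ hRm hRpos)] at hmono
  exact hmono

/-- **Finite-volume block-field domination**: for `β, h ≥ 0` and a plus box `Λ ⊇ B`,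
`⟨M_B e^{β h M_B}⟩⁺_{Λ;β,0} ≤ (∑_{x ∈ B} ⟨σ_x⟩⁺_{Λ;β,h}) · ⟨e^{β h M_B}⟩⁺_{Λ;β,0}`
(sum of `isingExpect_spinAt_mul_blockTilt_le` over the block, by linearity). -/
theorem isingExpect_blockSpin_mul_blockTilt_le {β h : ℝ} (hβ : 0 ≤ β) (hh : 0 ≤ h)
    {Λ B : Finset (Site d)} (hB : B ⊆ Λ) :
    isingExpect (zdGraph d) Λ β 0 .plus
        (fun σ => (∑ x ∈ B, spinAt x σ) * Real.exp (β * h * ∑ y ∈ B, spinAt y σ)) ≤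
      (∑ x ∈ B, isingExpect (zdGraph d) Λ β h .plus (spinAt x)) *
        isingExpect (zdGraph d) Λ β 0 .plus (fun σ => Real.exp (β * h * ∑ y ∈ B, spinAt y σ)) := by
  have hRm := measurable_blockTilt (d := d) β h B
  have h1 : (fun σ : SpinConfig (Site d) =>
      (∑ x ∈ B, spinAt x σ) * Real.exp (β * h * ∑ y ∈ B, spinAt y σ)) =
      fun σ => ∑ x ∈ B, spinAt x σ * Real.exp (β * h * ∑ y ∈ B, spinAt y σ) := by
    funext σ
    rw [Finset.sum_mul]
  rw [h1, isingExpect_finset_sum' _ _ _ _ β B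
    (fun x σ => spinAt x σ * Real.exp (β * h * ∑ y ∈ B, spinAt y σ))
    (fun x => (measurable_spinAt x).mul hRm), Finset.sum_mul]
  exact Finset.sum_le_sum fun x _ => isingExpect_spinAt_mul_blockTilt_le hβ hh hB x

/-- S3 — **BLOCK-FIELD DOMINATION** (GKS II / FKG): switching the field `h ≥ 0` on inside the block
only magnetises the block at most as much as the homogeneous field does,
`⟨M_L e^{β_c h M_L}⟩_{β_c,0} ≤ (2L+1)³ · m(β_c, h) · ⟨e^{β_c h M_L}⟩_{β_c,0}`
(tree field convention `exp(β Σσσ + β h Σσ)`; finite volume: monotonicity in site fields with plus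
boundary condition, `isingExpect_blockSpin_mul_blockTilt_le`; then `M → ∞` along plus boxes,
`tendsto_isingExpect_plus_spinFun`, and translation invariance `⟨σ_x⟩⁺_{β,h} = m(β,h)`,
`plusExpect_spinAt_eq_plusExpect_spinAt_zero`; `card_box`). -/
theorem stub_blockFieldDomination :
    ∀ (L : ℕ) (h : ℝ), 0 ≤ h →
      plusExpect 3 (criticalBeta 3) 0
          (fun σ => (∑ x ∈ box 3 L, spinAt x σ) *
            Real.exp (criticalBeta 3 * h * ∑ x ∈ box 3 L, spinAt x σ))
        ≤ (2 * L + 1) ^ 3 * magnetizationInField 3 (criticalBeta 3) h *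
          plusExpect 3 (criticalBeta 3) 0
            (fun σ => Real.exp (criticalBeta 3 * h * ∑ x ∈ box 3 L, spinAt x σ)) := by
  intro L h hh
  have hβ : 0 ≤ criticalBeta 3 := criticalBeta_nonneg 3
  -- the three box sequences converge
  have hA : Tendsto (fun M : ℕ => isingExpect (zdGraph 3) (box 3 M) (criticalBeta 3) 0 .plus
      (fun σ => (∑ x ∈ box 3 L, spinAt x σ) *
        Real.exp (criticalBeta 3 * h * ∑ x ∈ box 3 L, spinAt x σ))) atTop
      (𝓝 (plusExpect 3 (criticalBeta 3) 0 (fun σ => (∑ x ∈ box 3 L, spinAt x σ) *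
        Real.exp (criticalBeta 3 * h * ∑ x ∈ box 3 L, spinAt x σ)))) :=
    tendsto_isingExpect_plus_spinFun hβ le_rfl (box 3 L)
      (fun s => (∑ x ∈ box 3 L, s x) * Real.exp (criticalBeta 3 * h * ∑ x ∈ box 3 L, s x))
      (fun s t hst => by rw [Finset.sum_congr rfl hst])
  have hB : Tendsto (fun M : ℕ => isingExpect (zdGraph 3) (box 3 M) (criticalBeta 3) 0 .plus
      (fun σ => Real.exp (criticalBeta 3 * h * ∑ x ∈ box 3 L, spinAt x σ))) atTop
      (𝓝 (plusExpect 3 (criticalBeta 3) 0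
        (fun σ => Real.exp (criticalBeta 3 * h * ∑ x ∈ box 3 L, spinAt x σ)))) :=
    tendsto_isingExpect_plus_spinFun hβ le_rfl (box 3 L)
      (fun s => Real.exp (criticalBeta 3 * h * ∑ x ∈ box 3 L, s x))
      (fun s t hst => by rw [Finset.sum_congr rfl hst])
  have hC : ∀ x : Site 3, Tendsto (fun M : ℕ =>
      isingExpect (zdGraph 3) (box 3 M) (criticalBeta 3) h .plus (spinAt x)) atTop
      (𝓝 (magnetizationInField 3 (criticalBeta 3) h)) := by
    intro x
    have h1 : Tendsto (fun M : ℕ =>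
        isingExpect (zdGraph 3) (box 3 M) (criticalBeta 3) h .plus (spinAt x)) atTop
        (𝓝 (plusExpect 3 (criticalBeta 3) h (spinAt x))) :=
      tendsto_isingExpect_plus_spinFun hβ hh {x} (fun s => s x)
        (fun s t hst => hst x (Finset.mem_singleton_self x))
    rw [plusExpect_spinAt_eq_plusExpect_spinAt_zero (fun _ => ising_fkg_holds (zdGraph 3)) hβ h x]
      at h1
    exact h1
  have hlim : Tendsto (fun M : ℕ =>
      (∑ x ∈ box 3 L, isingExpect (zdGraph 3) (box 3 M) (criticalBeta 3) h .plus (spinAt x)) *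
        isingExpect (zdGraph 3) (box 3 M) (criticalBeta 3) 0 .plus
          (fun σ => Real.exp (criticalBeta 3 * h * ∑ x ∈ box 3 L, spinAt x σ))) atTop
      (𝓝 ((∑ _x ∈ box 3 L, magnetizationInField 3 (criticalBeta 3) h) *
        plusExpect 3 (criticalBeta 3) 0
          (fun σ => Real.exp (criticalBeta 3 * h * ∑ x ∈ box 3 L, spinAt x σ)))) :=
    (tendsto_finsetSum _ fun x _ => hC x).mul hB
  have hle := le_of_tendsto_of_tendsto hA hlim (by
    filter_upwards [eventually_ge_atTop L] with M hM
    exact isingExpect_blockSpin_mul_blockTilt_le hβ hh (box_mono 3 hM))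
  rw [Finset.sum_const, card_box, nsmul_eq_mul] at hle
  push_cast at hle
  exact hle

end Summit.CriticalPhenomena.Ising3DConformalLimit.PerfectScreeningCoulombImpliesNontrivial

end
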